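import Summits.Schanuel.Schanuel.Theorems.ZilberEacBoundedBranchDensity
import Mathlib.RingTheory.Polynomial.Eisenstein.Criterion
import HarnessLib

/-!
# Arbitrary base branches, LXVII (b): bounded branches — RATIONAL fibres and the conic
# `x₁² + x₀x₁ + x₀ = 0`

HONEST FRAMING.  Cell `pub-schanuel` (Zilber's Exponential-Algebraic Closedness, case ladder;
host summit Schanuel), seat 2, gen 31.  Corollaries of the bounded-branch engine of file LXVII:
* **`unprojectedDense_planeCurve_rationalFibre_boundedPlace`** — `F` irreducible of `x₁`-degree
  `≥ 2`, a bounded place `F(s^{-k}, Φ(s)) = 0`, `R, Q` nonzero somewhere on the curve: every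
  irreducible `S` of dimension `≤ 2` containing the graph of `(R/Q, e^{x₁})` over the curve off
  `Q = 0` has Zariski-dense exponential points — no direction condition;
* the conic `x₁² + x₀x₁ + x₀ = 0` (Eisenstein at `x₀`; rows `x₀, x₀, 1`; top row `t + 1` at level
  `1`: the branch `x₁ → -1`), **`unprojectedDensityQuestion_conicEisenstein_polyFibre`** /
  **`_fibre_x₁`**: case ∧ dense for every polynomial fibre — a conic whose only unbounded branch
  has the RATIONAL real direction `x₁ ~ -x₀`, out of reach of the growth method.
Decided instances of an OPEN question (Mantova–Masser, PLMS 2024 §1 p. 5); EC(3,2) OPEN; NOT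
Schanuel's conjecture (neither used nor implied); EAC ⇏ SC.
-/

noncomputable section

open Filter Topology Set Complex Polynomial
open Literature.NumberTheory.Transcendental Literature.ModelTheory.Zilber
open Literature.ModelTheory.ExponentialFields

set_option linter.dupNamespace false

namespace Summit.Schanuel.Schanuel.Theorems

/-! ## Part A. Rational fibres along a bounded branch -/

section RationalBounded

variable (F : ℂ[X][X])

/-- **Rational fibres along a bounded branch.**  `F` irreducible of `x₁`-degree `≥ 2`; a bounded
place `F(s^{-k}, Φ(s)) = 0` (`k ≥ 1`, `Φ` analytic); `R, Q ∈ ℂ[x₀, x₁]` nonzero somewhere on the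
curve; `S` irreducible closed of dimension `≤ 2` containing `(x, R(x)/Q(x), e^{x₁})` for all `x` on
the curve with `Q(x) ≠ 0`.  Then `S` has Zariski-dense exponential points.
[cite: MantovaMasser2023, §1 Further remarks, p. 5 (the question, open in general)] (new) -/
theorem unprojectedDense_planeCurve_rationalFibre_boundedPlace (hFirr : Irreducible F)
    (hn : 2 ≤ F.natDegree) {k : ℕ} (hk : 1 ≤ k) {Φ : ℂ → ℂ} (hΦan : AnalyticAt ℂ Φ 0)
    (hplace : ∀ᶠ s in 𝓝[≠] (0 : ℂ), (F.map (Polynomial.evalRingHom (s ^ k)⁻¹)).eval (Φ s) = 0)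
    (R Q : MvPolynomial (Fin 2) ℂ)
    (hR : ∃ x y : ℂ, (F.map (Polynomial.evalRingHom x)).eval y = 0 ∧ MvPolynomial.eval ![x, y] R ≠ 0)
    (hQ : ∃ x y : ℂ, (F.map (Polynomial.evalRingHom x)).eval y = 0 ∧ MvPolynomial.eval ![x, y] Q ≠ 0)
    {S : Set (Fin 2 ⊕ Fin 2 → ℂ)} (hS : IsIrreducibleClosed ℂ S) (hdim : zariskiDim ℂ S ≤ (2 : ℕ))
    (hsub : ∀ x y : ℂ, (F.map (Polynomial.evalRingHom x)).eval y = 0 →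
      MvPolynomial.eval ![x, y] Q ≠ 0 →
      (Sum.elim ![x, y] ![MvPolynomial.eval ![x, y] R / MvPolynomial.eval ![x, y] Q, Complex.exp y] :
        Fin 2 ⊕ Fin 2 → ℂ) ∈ S) :
    UnprojectedDense S := by
  classical
  obtain ⟨Φr, hΦr⟩ := exists_rowsEquiv
  have hndvdR : ¬ F ∣ Φr R := by
    refine not_dvd_of_exists_eval_ne_zero F ?_
    obtain ⟨x, y, hxy, hne⟩ := hR
    exact ⟨x, y, hxy, by rw [← hΦr]; exact hne⟩
  have hndvdQ : ¬ F ∣ Φr Q := by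
    refine not_dvd_of_exists_eval_ne_zero F ?_
    obtain ⟨x, y, hxy, hne⟩ := hQ
    exact ⟨x, y, hxy, by rw [← hΦr]; exact hne⟩
  have hplace' : ∀ᶠ s in 𝓝[≠] (0 : ℂ),
      (F.map (Polynomial.evalRingHom (s ^ k)⁻¹)).eval (Φ s * (s ^ 0)⁻¹) = 0 := by
    filter_upwards [hplace] with s hs
    rwa [pow_zero, inv_one, mul_one]
  obtain ⟨ψR, LR, hψRan, hψR0, hfR⟩ :=
    exists_rows_place_normalForm F hFirr (by omega) (Φr R) hndvdR hk 0 hΦan hplace'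
  obtain ⟨ψQ, LQ, hψQan, hψQ0, hfQ⟩ :=
    exists_rows_place_normalForm F hFirr (by omega) (Φr Q) hndvdQ hk 0 hΦan hplace'
  have hψQne : ∀ᶠ s in 𝓝 (0 : ℂ), ψQ s ≠ 0 := hψQan.continuousAt.eventually_ne hψQ0
  refine unprojectedDense_boundedBranch F hS hdim hFirr hn hk hΦan hplace (LR - LQ)
    (hψRan.div hψQan hψQ0) (div_ne_zero hψR0 hψQ0) ?_
  filter_upwards [hplace, hfR, hfQ, self_mem_nhdsWithin, nhdsWithin_le_nhds hψQne] with s hs hsR hsQ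
    (hs0 : s ≠ 0) hψQs
  rw [pow_zero, inv_one, mul_one] at hsR hsQ
  have hQne : MvPolynomial.eval ![(s ^ k)⁻¹, Φ s] Q ≠ 0 := by
    rw [hΦr, hsQ]
    exact mul_ne_zero hψQs (zpow_ne_zero _ hs0)
  have hmem := hsub _ _ hs hQne
  have hval : MvPolynomial.eval ![(s ^ k)⁻¹, Φ s] R / MvPolynomial.eval ![(s ^ k)⁻¹, Φ s] Q =
      ψR s / ψQ s * s ^ (LR - LQ) := by
    rw [hΦr, hΦr, hsR, hsQ, zpow_sub₀ hs0]
    field_simp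
  rw [hval] at hmem
  exact hmem

end RationalBounded

/-! ## Part E. Example: the conic `x₁² + x₀x₁ + x₀ = 0` -/

section ConicEisenstein

/-- Auxiliary computation for the example (`conicEisenstein_eval`). [folklore] -/
private theorem conicEisenstein_eval (x y : ℂ) :
    ((X ^ 2 + Polynomial.C (X : ℂ[X]) * X + Polynomial.C (X : ℂ[X]) : ℂ[X][X]).map
        (Polynomial.evalRingHom x)).eval y = y ^ 2 + x * y + x := by
  simp

/-- Auxiliary computation for the example (`conicEisenstein_natDegree`). [folklore] -/
private theorem conicEisenstein_natDegree :
    (X ^ 2 + Polynomial.C (X : ℂ[X]) * X + Polynomial.C (X : ℂ[X]) : ℂ[X][X]).natDegree = 2 := by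
  compute_degree!

/-- Auxiliary computation for the example (`conicEisenstein_coeff`). [folklore] -/
private theorem conicEisenstein_coeff (j : ℕ) :
    (X ^ 2 + Polynomial.C (X : ℂ[X]) * X + Polynomial.C (X : ℂ[X]) : ℂ[X][X]).coeff j =
      if j = 2 then 1 else if j = 1 then X else if j = 0 then X else 0 := by
  simp only [Polynomial.coeff_add, Polynomial.coeff_X_pow, Polynomial.coeff_C_mul, Polynomial.coeff_X,
    Polynomial.coeff_C]
  rcases j with _ | _ | _ | j <;> simp

/-- Auxiliary computation for the example (`conicEisenstein_monic`). [folklore] -/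
private theorem conicEisenstein_monic :
    (X ^ 2 + Polynomial.C (X : ℂ[X]) * X + Polynomial.C (X : ℂ[X]) : ℂ[X][X]).Monic := by
  rw [Polynomial.Monic, Polynomial.leadingCoeff, conicEisenstein_natDegree, conicEisenstein_coeff]
  simp

/-- `x₁² + x₀x₁ + x₀` is irreducible (Eisenstein at `x₀`). [folklore] -/
private theorem conicEisenstein_irreducible :
    Irreducible (X ^ 2 + Polynomial.C (X : ℂ[X]) * X + Polynomial.C (X : ℂ[X]) : ℂ[X][X]) := by
  set F : ℂ[X][X] := X ^ 2 + Polynomial.C (X : ℂ[X]) * X + Polynomial.C (X : ℂ[X]) with hF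
  have hP : (Ideal.span {(X : ℂ[X])}).IsPrime :=
    (Ideal.span_singleton_prime Polynomial.X_ne_zero).2 Polynomial.prime_X
  have hdeg : F.degree = 2 := by
    rw [Polynomial.degree_eq_natDegree conicEisenstein_monic.ne_zero, conicEisenstein_natDegree]; rfl
  refine Polynomial.irreducible_of_eisenstein_criterion hP ?_ ?_ ?_ ?_ conicEisenstein_monic.isPrimitive
  · rw [conicEisenstein_monic.leadingCoeff, Ideal.mem_span_singleton]
    intro h
    have := Polynomial.natDegree_le_of_dvd h one_ne_zero
    rw [Polynomial.natDegree_X, Polynomial.natDegree_one] at this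
    exact Nat.not_succ_le_zero 0 this
  · intro n hn
    rw [hdeg] at hn
    have hn2 : n < 2 := by exact_mod_cast hn
    rw [conicEisenstein_coeff, Ideal.mem_span_singleton]
    interval_cases n <;> simp
  · rw [hdeg]; norm_num
  · rw [conicEisenstein_coeff, Ideal.span_singleton_pow, Ideal.mem_span_singleton]
    simp only [show ¬ (0 : ℕ) = 2 by norm_num, show ¬ (0 : ℕ) = 1 by norm_num, if_false, if_true]
    intro h
    have := Polynomial.natDegree_le_of_dvd h Polynomial.X_ne_zero
    rw [Polynomial.natDegree_pow, Polynomial.natDegree_X] at this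
    omega

/-- **`{x₁² + x₀x₁ + x₀ = 0, y₀ = R(x₀, x₁)}`: case ∧ dense for every `R` nonzero somewhere on
the conic** — the branch `x₁ → -1` as `x₀ → ∞` (rows `x₀, x₀, 1` of degrees `1, 1, 0`: top row
`t + 1` at level `N = 1`); the other branch `x₁ ~ -x₀` has a rational real direction and is out of
reach of the growth method. [cite: MantovaMasser2023, §1 Further remarks, p. 5 (the question, open
in general)] (new) -/
theorem unprojectedDensityQuestion_conicEisenstein_polyFibre (R : MvPolynomial (Fin 2) ℂ)
    (hR : ∃ x y : ℂ, y ^ 2 + x * y + x = 0 ∧ MvPolynomial.eval ![x, y] R ≠ 0) :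
    MMCaseDimPiOneFree {w : Fin 2 ⊕ Fin 2 → ℂ |
        w (Sum.inl 1) ^ 2 + w (Sum.inl 0) * w (Sum.inl 1) + w (Sum.inl 0) = 0 ∧
        w (Sum.inr 0) = MvPolynomial.eval ![w (Sum.inl 0), w (Sum.inl 1)] R} ∧
      UnprojectedDense {w : Fin 2 ⊕ Fin 2 → ℂ |
        w (Sum.inl 1) ^ 2 + w (Sum.inl 0) * w (Sum.inl 1) + w (Sum.inl 0) = 0 ∧
        w (Sum.inr 0) = MvPolynomial.eval ![w (Sum.inl 0), w (Sum.inl 1)] R} := by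
  have hset : {w : Fin 2 ⊕ Fin 2 → ℂ |
      w (Sum.inl 1) ^ 2 + w (Sum.inl 0) * w (Sum.inl 1) + w (Sum.inl 0) = 0 ∧
      w (Sum.inr 0) = MvPolynomial.eval ![w (Sum.inl 0), w (Sum.inl 1)] R} =
      {w : Fin 2 ⊕ Fin 2 → ℂ |
        ((X ^ 2 + Polynomial.C (X : ℂ[X]) * X + Polynomial.C (X : ℂ[X]) : ℂ[X][X]).map
          (Polynomial.evalRingHom (w (Sum.inl 0)))).eval (w (Sum.inl 1)) = 0 ∧
        w (Sum.inr 0) = MvPolynomial.eval ![w (Sum.inl 0), w (Sum.inl 1)] R} := by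
    ext w; simp only [Set.mem_setOf_eq, conicEisenstein_eval]
  rw [hset]
  refine unprojectedDensityQuestion_planeCurve_polyFibre_of_topRow _ conicEisenstein_irreducible
    (by rw [conicEisenstein_natDegree]) 1 ?_ ⟨1, le_rfl, ?_⟩ R ?_
  · intro j
    rw [conicEisenstein_coeff]
    split_ifs <;> simp
  · rw [conicEisenstein_coeff]; simp
  · obtain ⟨x, y, hxy, hne⟩ := hR
    exact ⟨x, y, by rw [conicEisenstein_eval]; exact hxy, hne⟩

/-- **`{x₁² + x₀x₁ + x₀ = 0, y₀ = x₁}`: case ∧ dense.** [cite: MantovaMasser2023, §1 Further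
remarks, p. 5 (the question, open in general)] (new) -/
theorem unprojectedDensityQuestion_conicEisenstein_fibre_x₁ :
    MMCaseDimPiOneFree {w : Fin 2 ⊕ Fin 2 → ℂ |
        w (Sum.inl 1) ^ 2 + w (Sum.inl 0) * w (Sum.inl 1) + w (Sum.inl 0) = 0 ∧
        w (Sum.inr 0) = w (Sum.inl 1)} ∧
      UnprojectedDense {w : Fin 2 ⊕ Fin 2 → ℂ |
        w (Sum.inl 1) ^ 2 + w (Sum.inl 0) * w (Sum.inl 1) + w (Sum.inl 0) = 0 ∧
        w (Sum.inr 0) = w (Sum.inl 1)} := by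
  have h := unprojectedDensityQuestion_conicEisenstein_polyFibre (MvPolynomial.X 1)
    ⟨(-1 / 2 : ℂ), 1, by norm_num, by simp⟩
  simpa only [MvPolynomial.eval_X, Matrix.cons_val_one, Matrix.cons_val_zero] using h

end ConicEisenstein

end Summit.Schanuel.Schanuel.Theorems

end
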